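import Summits.AtomisticToContinuum.HydrodynamicLimit.Theses.LindebergRandomFuture
import Summits.AtomisticToContinuum.HydrodynamicLimit.Theorems.LambertianContactSwapLambertianEulerOfHearts
import Summits.AtomisticToContinuum.HydrodynamicLimit.Theses.LambertianContactSwap
import Summits.AtomisticToContinuum.HydrodynamicLimit.Theorems.LambertianContactSwapLambertianEulerArchimedes
import Summits.AtomisticToContinuum.HydrodynamicLimit.Theorems.LambertianContactSwapLambertianEulerLambertLaw
import Summits.AtomisticToContinuum.HydrodynamicLimit.Theorems.LambertianContactSwapLambertianEulerPovzner
import Summits.AtomisticToContinuum.HydrodynamicLimit.Theorems.LambertianContactSwapLambertianEulerPairPovzner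
import Summits.AtomisticToContinuum.HydrodynamicLimit.Theorems.LambertianContactSwapLambertianEulerContactIsotropy
import Summits.AtomisticToContinuum.HydrodynamicLimit.Theorems.LambertianContactSwapLambertianEulerMomentLedgerChain
import Summits.AtomisticToContinuum.HydrodynamicLimit.Theorems.LambertianContactSwapLambertianEulerGibbsInvariance
import Summits.AtomisticToContinuum.HydrodynamicLimit.Theorems.LambertianContactSwapLambertianEulerEntropyToHydro
import Summits.AtomisticToContinuum.HydrodynamicLimit.Theorems.LambertianContactSwapLambertianEulerWindow
import Summits.AtomisticToContinuum.HydrodynamicLimit.Theorems.LambertianContactSwapLambertianEulerMarkov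
import Summits.AtomisticToContinuum.HydrodynamicLimit.Theorems.LambertianContactSwapLambertianEulerIterate
import Summits.AtomisticToContinuum.HydrodynamicLimit.Theorems.LambertianContactSwapLambertianEulerDock
import Summits.AtomisticToContinuum.HydrodynamicLimit.Theorems.LambertianContactSwapLambertianEulerKlLedger
import Summits.AtomisticToContinuum.HydrodynamicLimit.Theorems.LambertianContactSwapLambertianEulerLawSemigroup
import Summits.AtomisticToContinuum.HydrodynamicLimit.Theorems.LambertianContactSwapLambertianEulerDockRf
import Summits.AtomisticToContinuum.HydrodynamicLimit.Theorems.LambertianContactSwapLambertianEulerLambertDirMean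
import Summits.AtomisticToContinuum.HydrodynamicLimit.Theorems.LambertianContactSwapLambertianEulerPairMeanSq
import Summits.AtomisticToContinuum.HydrodynamicLimit.Theorems.LambertianContactSwapLambertianEulerPathwiseProduction
import Summits.AtomisticToContinuum.HydrodynamicLimit.Theorems.LambertianContactSwapLambertianEulerWindowLedger
import Summits.AtomisticToContinuum.HydrodynamicLimit.Theorems.LambertianContactSwapLambertianEulerCollisionCompensator
import Summits.AtomisticToContinuum.HydrodynamicLimit.Theorems.LambertianContactSwapLambertianEulerCompensatedJump
import Summits.AtomisticToContinuum.HydrodynamicLimit.Theorems.LambertianContactSwapLambertianEulerAprioriEntropyBound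
import Summits.AtomisticToContinuum.HydrodynamicLimit.Theorems.LambertianContactSwapLambertianEulerCollisionIntensity
import Summits.AtomisticToContinuum.HydrodynamicLimit.Theorems.LambertianContactSwapLambertianEulerTwoTimeLaw
import Summits.AtomisticToContinuum.HydrodynamicLimit.Theorems.LambertianContactSwapLambertianEulerCollisionBudget
import Summits.AtomisticToContinuum.HydrodynamicLimit.Theorems.LambertianContactSwapLambertianEulerExpectedWindowProductionTools
import Summits.AtomisticToContinuum.HydrodynamicLimit.Theorems.LambertianContactSwapLambertianEulerExpectedWindowProduction
import Summits.AtomisticToContinuum.HydrodynamicLimit.Theorems.LambertianContactSwapLambertianEulerProductionSplit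
import Summits.AtomisticToContinuum.HydrodynamicLimit.Theorems.TwoClocksClampedEntropyClockTimeZeroReference
import Summits.AtomisticToContinuum.HydrodynamicLimit.Theorems.TwoClocksClampedEntropyClockDiscreteEntropyGronwall
import Summits.AtomisticToContinuum.HydrodynamicLimit.Theorems.TwoClocksClampedEntropyClockKlDivLawAtLocalGibbsNeTop
import Summits.AtomisticToContinuum.HydrodynamicLimit.Theorems.DenseExcursion.Negative.EntropyTransport
import Literature.MathematicalPhysics.KineticTheory.LambertianRedrawNondegenerate
import Literature.MathematicalPhysics.KineticTheory.Hilbert6Wave0Proofs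
import Literature.MathematicalPhysics.KineticTheory.HardSphereEulerLLN
import Literature.Barriers.AtomisticToContinuum.HighMomentumCutoff
import Literature.Analysis.FluidPDE.HardSphereAlexander
import HarnessLib

/-! TTRL-lite variant V13070 of stmt-AtomisticToContinuum-11854

Entropy minimum principle for classical IDEAL-gas solutions (`σ = 0`: `p = ρθ` exactly, since
`Z(0) = 1`): the specific entropy `s = (3/2) log θ - log ρ` is transported, `∂ₜ s = -u·∇s`, hence by
the transport minimum principle (`DenseExcursionEntropyBudget.transport_min_principle`)
`min_y s(0,y) ≤ s(t,x)`, i.e. `θ_t/ρ_t^{2/3} ≥ inf_y θ_0/ρ_0^{2/3}` ("compression heats the gas").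
-/

noncomputable section

namespace Summit.AtomisticToContinuum.HydrodynamicLimit.Theorems

open scoped BigOperators Topology ENNReal InnerProductSpace
open MeasureTheory ProbabilityTheory Filter Set InformationTheory
open Literature.MathematicalPhysics.KineticTheory
open Literature.Analysis.FluidPDE Literature.Analysis.FluidPDE.Alexander
open Summit.AtomisticToContinuum.HydrodynamicLimit.Theses.LambertianContactSwap
open Summit.AtomisticToContinuum.HydrodynamicLimit.Theorems.ClampedCurrentsDockPathwise (gSum DgSum)
open Literature.Analysis.FunctionSpaces
open scoped ContDiff

/-- The ideal-gas specific entropy `s = (3/2) log θ - log ρ` of a classical solution with `σ = 0` is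
jointly smooth on `[0, T) × 𝕋³` (`log` is smooth away from `0`; `ρ, θ > 0`). [folklore] -/
theorem idealEnt_isSmoothSpaceTimeOn_var13070 {T : ℝ} {ρ θ : ℝ → T3 → ℝ} {u : ℝ → T3 → V3}
    (hE : IsHardSphereEulerSolution 0 T ρ u θ) :
    Torus.IsSmoothSpaceTimeOn (Ico 0 T)
      (fun t y => 3 / 2 * Real.log (θ t y) - Real.log (ρ t y)) := by
  have hθne : MapsTo (Torus.stLift θ) (Ico 0 T ×ˢ (univ : Set (EuclideanSpace ℝ (Fin 3))))
      ({0}ᶜ : Set ℝ) := by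
    rintro ⟨t, v⟩ hz
    exact (hE.temperature_pos t (mem_prod.1 hz).1 _).ne'
  have hρne : MapsTo (Torus.stLift ρ) (Ico 0 T ×ˢ (univ : Set (EuclideanSpace ℝ (Fin 3))))
      ({0}ᶜ : Set ℝ) := by
    rintro ⟨t, v⟩ hz
    exact (hE.density_pos t (mem_prod.1 hz).1 _).ne'
  have h1 : ContDiffOn ℝ ∞ (fun z => Real.log (Torus.stLift θ z)) (Ico 0 T ×ˢ univ) :=
    Real.contDiffOn_log.comp hE.smooth_temperature hθne
  have h2 : ContDiffOn ℝ ∞ (fun z => Real.log (Torus.stLift ρ z)) (Ico 0 T ×ˢ univ) :=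
    Real.contDiffOn_log.comp hE.smooth_density hρne
  change ContDiffOn ℝ ∞ (fun z => 3 / 2 * Real.log (Torus.stLift θ z) - Real.log (Torus.stLift ρ z))
    (Ico 0 T ×ˢ univ)
  exact (contDiffOn_const.mul h1).sub h2

/-- **Entropy transport for the ideal gas (`σ = 0`).** Along a classical solution of the
hard-sphere Euler system at `σ = 0` (pressure `p = ρθ`), the specific entropy
`s = (3/2) log θ - log ρ` satisfies `∂ₜ s = -∑ᵢ uᵢ ∂ᵢ s` pointwise on `[0, T) × 𝕋³` (primitive mass
and temperature equations with `ζ ≡ 1`). [folklore] -/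
theorem idealEnt_transport_var13070 {T : ℝ} {ρ θ : ℝ → T3 → ℝ} {u : ℝ → T3 → V3}
    (hE : IsHardSphereEulerSolution 0 T ρ u θ) {t : ℝ} (ht : t ∈ Ico 0 T) (x : T3) :
    Torus.timeDerivWithin (Ico 0 T) (fun t y => 3 / 2 * Real.log (θ t y) - Real.log (ρ t y)) t x =
      -∑ i, u t x i *
        Torus.partialDeriv i (fun y => 3 / 2 * Real.log (θ t y) - Real.log (ρ t y)) x := by
  have hU : UniqueDiffOn ℝ (Ico (0 : ℝ) T) := uniqueDiffOn_Ico 0 T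
  have hJ : IsOpen (univ : Set ℝ) := isOpen_univ
  have hζ : ContDiffOn ℝ ∞ (fun _ : ℝ => (1 : ℝ)) univ := contDiffOn_const
  have hρJ : ∀ t ∈ Ico 0 T, ∀ x, ρ t x ∈ (univ : Set ℝ) := fun _ _ _ => mem_univ _
  have hp : ∀ t ∈ Ico 0 T, ∀ x,
      hsPressure 0 (ρ t x) (θ t x) = ρ t x * θ t x * (fun _ : ℝ => (1 : ℝ)) (ρ t x) := by
    intro t _ x
    simp [hsPressure, hsCompressibility]
  have hρ1 : Torus.IsContDiff 1 (ρ t) := (hE.smooth_density.isSmooth_slice ht).isContDiff (by simp)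
  have hθ1 : Torus.IsContDiff 1 (θ t) :=
    (hE.smooth_temperature.isSmooth_slice ht).isContDiff (by simp)
  have hρne : ρ t x ≠ 0 := (hE.density_pos t ht x).ne'
  have hθne : θ t x ≠ 0 := (hE.temperature_pos t ht x).ne'
  -- time-slice derivatives
  have sρ := hE.smooth_density.hasDerivWithinAt_slice ht x
  have sθ := hE.smooth_temperature.hasDerivWithinAt_slice ht x
  have hA : Torus.timeDerivWithin (Ico 0 T)
      (fun t y => 3 / 2 * Real.log (θ t y) - Real.log (ρ t y)) t x =
      3 / 2 * (Torus.timeDerivWithin (Ico 0 T) θ t x / θ t x) -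
        Torus.timeDerivWithin (Ico 0 T) ρ t x / ρ t x := by
    refine timeDerivWithin_eq_of_hasDerivWithinAt
      (F := fun t y => 3 / 2 * Real.log (θ t y) - Real.log (ρ t y)) ?_ (hU t ht)
    show HasDerivWithinAt (fun τ => 3 / 2 * Real.log (θ τ x) - Real.log (ρ τ x)) _ _ _
    exact ((sθ.log hθne).const_mul (3 / 2)).sub (sρ.log hρne)
  -- coordinate-line derivatives
  have cρ := fun i => hasDerivAt_coordLine hρ1 x i
  have cθ := fun i => hasDerivAt_coordLine hθ1 x i
  have hB : ∀ i : Fin 3,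
      Torus.partialDeriv i (fun y => 3 / 2 * Real.log (θ t y) - Real.log (ρ t y)) x =
      3 / 2 * (Torus.partialDeriv i (θ t) x / θ t x) - Torus.partialDeriv i (ρ t) x / ρ t x := by
    intro i
    have hθne' : θ t (x + Torus.proj ((0 : ℝ) • EuclideanSpace.single i (1 : ℝ))) ≠ 0 := by
      simpa only [zero_smul, Torus.proj_zero, add_zero] using hθne
    have hρne' : ρ t (x + Torus.proj ((0 : ℝ) • EuclideanSpace.single i (1 : ℝ))) ≠ 0 := by
      simpa only [zero_smul, Torus.proj_zero, add_zero] using hρne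
    refine partialDeriv_eq_of_hasDerivAt
      (F := fun y => 3 / 2 * Real.log (θ t y) - Real.log (ρ t y)) ?_
    show HasDerivAt (fun s : ℝ =>
      3 / 2 * Real.log (θ t (x + Torus.proj (s • EuclideanSpace.single i (1 : ℝ)))) -
      Real.log (ρ t (x + Torus.proj (s • EuclideanSpace.single i (1 : ℝ))))) _ 0
    have h := (((cθ i).log hθne').const_mul (3 / 2)).sub ((cρ i).log hρne')
    refine h.congr_deriv ?_
    simp only [zero_smul, Torus.proj_zero, add_zero]
  have hP1 := hsEuler_density_eq hE ht x
  have hP3 := hsEuler_temperature_eq hE hJ hζ hρJ hp ht x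
  rw [hA]
  simp only [hB]
  rw [hP1, hP3]
  simp only [Fin.sum_univ_three]
  field_simp
  ring

/-- **TTRL-lite variant V13070 of `stub_diluteSelfConsistency` (stmt-AtomisticToContinuum-11854):
entropy minimum principle for classical ideal-gas solutions.** Along every classical solution of the
hard-sphere Euler system at `σ = 0` (`p = ρθ`), `θ(t,x)/ρ(t,x)^{2/3} ≥ inf_y θ(0,y)/ρ(0,y)^{2/3}` for
all `t ∈ [0, T)`, `x ∈ 𝕋³`: `θ/ρ^{2/3} = exp(2s/3)` with `s` the transported specific entropy, and the
transport minimum principle. [folklore] -/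
theorem stub_diluteSelfConsistency_var13070 :
    ∀ (T : ℝ) (ρ θ : ℝ → T3 → ℝ) (u : ℝ → T3 → V3), IsHardSphereEulerSolution 0 T ρ u θ →
      ∀ t ∈ Set.Ico 0 T, ∀ x,
        (⨅ y, θ 0 y / ρ 0 y ^ (2 / 3 : ℝ)) ≤ θ t x / ρ t x ^ (2 / 3 : ℝ) := by
  intro T ρ θ u hE t ht x
  obtain ⟨y, hy⟩ := DenseExcursionEntropyBudget.transport_min_principle
    (idealEnt_isSmoothSpaceTimeOn_var13070 hE)
    (fun s hs z => idealEnt_transport_var13070 hE hs z) ht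
  have h0 : (0 : ℝ) ∈ Ico 0 T := ⟨le_rfl, ht.1.trans_lt ht.2⟩
  -- `θ/ρ^{2/3} = exp (2/3 · s)`
  have key : ∀ {s : ℝ}, s ∈ Ico 0 T → ∀ z : T3, θ s z / ρ s z ^ (2 / 3 : ℝ) =
      Real.exp (2 / 3 * (3 / 2 * Real.log (θ s z) - Real.log (ρ s z))) := by
    intro s hs z
    have hρ := hE.density_pos s hs z
    have hθ := hE.temperature_pos s hs z
    have e : 2 / 3 * (3 / 2 * Real.log (θ s z) - Real.log (ρ s z)) =
        Real.log (θ s z) - Real.log (ρ s z) * (2 / 3) := by ring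
    rw [e, Real.exp_sub, Real.exp_log hθ, ← Real.rpow_def_of_pos hρ]
  have hyx : 3 / 2 * Real.log (θ 0 y) - Real.log (ρ 0 y) ≤
      3 / 2 * Real.log (θ t x) - Real.log (ρ t x) := hy x
  have hmono : θ 0 y / ρ 0 y ^ (2 / 3 : ℝ) ≤ θ t x / ρ t x ^ (2 / 3 : ℝ) := by
    rw [key h0 y, key ht x]
    exact Real.exp_le_exp.2 (by linarith)
  refine le_trans (ciInf_le ⟨0, ?_⟩ y) hmono
  rintro _ ⟨z, rfl⟩
  exact div_nonneg (hE.temperature_pos 0 h0 z).le (Real.rpow_nonneg (hE.density_pos 0 h0 z).le _)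

end Summit.AtomisticToContinuum.HydrodynamicLimit.Theorems

end
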